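import Summits.FinalStateConjecture.FinalStateConjecture.Theorems.ClusterCompletenessAdiabaticMultiKerrILEDTailsCutWeightedGraph
import Literature.NumberTheory.Sieve.GreenTao2008PseudorandomMajorantProofs
import Literature.Geometry.Lorentzian.KerrDecayHierarchyProofs
import Literature.Geometry.Lorentzian.KerrSchildLocalEnergy
import Literature.Geometry.Lorentzian.KerrSchildEnergyEstimate
import Literature.Topology.FourManifolds.RadialLinearization

/-!
# Route ClusterCompleteness — crux `AdiabaticMultiKerrILED`, line `Sketch`:
# limit bookkeeping for the degenerate integrated local energy decay estimate (rest frame)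

Helper file for the crux `stmt-FinalStateConjecture-14310`
(`Summit.FinalStateConjecture.FinalStateConjecture.Theses.ClusterCompleteness.AdiabaticMultiKerrILED`),
line `Sketch`, stub `restFrame_degenerateILED_zeroSpin` (lead c7, wave 6), first auxiliary file:
the generic pieces of the assembly of the degenerate Morawetz estimate of the static tails-cut
Schwarzschild zone that do not involve the Morawetz current. Notation: `χ = Real.smoothTransition`,
`u₂ = Kerr.horizonFn M 0 = (r − 2M)e^{−x⁰/2M}` (`r = Kerr.radius 0 = ‖x⃗‖`), receding horizon factor
`W_h = χ(u₂/ε − 1)`, static cut-off `W_R = χ(2 − ‖x⃗‖²/R²)`, tilted leaves `(u + F(y), y)`.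

* `degILED_deriv_mul_bounds` — `0 ≤ χ′(t)(t + 1) ≤ 4` (`χ′ = 0` off `[0, 1]`, the Literature
  lemma `FourManifolds.deriv_smoothTransition_eq_zero`, and Green–Tao's `χ′ ≤ 2`);
* `degILED_fderiv_staticCutoff_eq_zero` — `dW_R = 0` off the layer `{R² ≤ ‖x⃗‖² ≤ 2R²}`;
* `degILED_div_pointwise` — product rule `∑∂(W_h W_R J) = W∑∂J + W_R∑∂W_h J + W_h∑∂W_R J` and the
  pointwise divergence inequality with error terms;
* `degILED_horizonError_tendsto` — the slab integral of the horizon-layer error density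
  `W_R K χ′(u₂/ε_n − 1)(u₂/ε_n) D/M`, `ε_n = ε/(n+1)`, tends to `0` (dominated convergence in `y` and
  in `u`: the densities are bounded by `4K|D|/M`, supported in `‖y‖ ≤ 2R`, eventually zero pointwise);
* `degILED_abs_integral_le` — `|∫ g| ≤ c ∫⁻_S q` when `|g| ≤ c q 𝟙_S`;
* `degILED_exhaustion` — **registered stub**: slab bounds `∫_{(0,n]} ∫_{2M<‖y‖≤n} b ≤ Λ` pass to
  `∫_{(0,∞)} ∫_{2M<‖y‖} b ≤ Λ` (leaf integrals are space-time integrals of the continuous modification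
  `χ(r/M − 1) b`, `Kerr.lintegral_lintegral_leafPoint_eq`; monotone convergence).

Dafermos–Rodnianski arXiv:0811.0354, §4.1; Dafermos–Rodnianski–Shlapentokh-Rothman arXiv:1402.7034,
§2.3.2, §13.2 (the limit `ε → 0` of the receding cut-off). [folklore]
-/

noncomputable section

-- the doubled `FinalStateConjecture.FinalStateConjecture` path component trips dupNamespace
set_option linter.dupNamespace false

open Set Filter Metric MeasureTheory
open scoped BigOperators Topology ENNReal
open Literature.Geometry.Lorentzian

namespace Summit.FinalStateConjecture.FinalStateConjecture.Theorems

/-! ### The smooth step and the static cut-off -/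

/-- `0 ≤ χ′(t)(t + 1) ≤ 4` (`0 ≤ χ′ ≤ 2`, Green–Tao's `deriv_smoothTransition_le_two`, and
`χ′ = 0` off `[0, 1]`). [folklore] -/
theorem degILED_deriv_mul_bounds (t : ℝ) :
    0 ≤ deriv Real.smoothTransition t * (t + 1) ∧ deriv Real.smoothTransition t * (t + 1) ≤ 4 := by
  by_cases h : t < 0 ∨ 1 < t
  · rw [Literature.Topology.FourManifolds.deriv_smoothTransition_eq_zero h, zero_mul]
    exact ⟨le_rfl, by norm_num⟩
  · rw [not_or, not_lt, not_lt] at h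
    have h0 := Literature.NumberTheory.Sieve.GreenTao2008.deriv_smoothTransition_nonneg t
    have h2 := Literature.NumberTheory.Sieve.GreenTao2008.deriv_smoothTransition_le_two t
    exact ⟨mul_nonneg h0 (by linarith [h.1]), by nlinarith [h.1, h.2]⟩

/-- **The static cut-off is locally constant off its layer**: `dW_R(x) = 0` when `‖x⃗‖² < R²`
(`W_R = 1` nearby) or `‖x⃗‖² > 2R²` (`W_R = 0` nearby), `R > 0`. [folklore] -/
theorem degILED_fderiv_staticCutoff_eq_zero {R : ℝ} (hR : 0 < R) {x : E4}
    (hx : E4.spatialNorm x ^ 2 < R ^ 2 ∨ 2 * R ^ 2 < E4.spatialNorm x ^ 2) :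
    fderiv ℝ (fun y : E4 ↦ Real.smoothTransition (2 - E4.spatialNorm y ^ 2 / R ^ 2)) x = 0 := by
  have hc : Continuous fun y : E4 ↦ E4.spatialNorm y ^ 2 :=
    (Kerr.contDiff_spatialNorm_sq (n := 0)).continuous
  have hR2 : (0 : ℝ) < R ^ 2 := by positivity
  rcases hx with hx | hx
  · have hev : (fun y : E4 ↦ Real.smoothTransition (2 - E4.spatialNorm y ^ 2 / R ^ 2)) =ᶠ[𝓝 x]
        fun _ ↦ (1 : ℝ) := by
      filter_upwards [hc.continuousAt.eventually_lt continuousAt_const hx] with y hy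
      refine Real.smoothTransition.one_of_one_le ?_
      have : E4.spatialNorm y ^ 2 / R ^ 2 < 1 := (div_lt_one hR2).2 hy
      linarith
    rw [hev.fderiv_eq, fderiv_const_apply]
  · have hev : (fun y : E4 ↦ Real.smoothTransition (2 - E4.spatialNorm y ^ 2 / R ^ 2)) =ᶠ[𝓝 x]
        fun _ ↦ (0 : ℝ) := by
      filter_upwards [continuousAt_const.eventually_lt hc.continuousAt hx] with y hy
      refine Real.smoothTransition.zero_of_nonpos ?_
      rw [sub_nonpos, le_div_iff₀ hR2]
      linarith
    rw [hev.fderiv_eq, fderiv_const_apply]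

/-! ### The pointwise divergence inequality with error terms -/

/-- **Product rule and pointwise divergence inequality.** For weights `W_h, W_R ≥ 0` and a current
`J` differentiable at `x`:
`∑_μ ∂_μ(W_h W_R J^μ) = W_h W_R ∑_μ ∂_μJ^μ + W_R ∑_μ ∂_μW_h J^μ + W_h ∑_μ ∂_μW_R J^μ`; hence if
`𝔅 ≤ ∑ ∂J`, `ℓ ≤ W_h W_R 𝔅` and `−e_h ≤ W_R ∑ ∂W_h J`, then
`ℓ − (e_h + W_h |∑ ∂W_R J|) ≤ ∑_μ ∂_μ(W_h W_R J^μ)`. [folklore] -/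
theorem degILED_div_pointwise {Wh WR B ℓ eh : E4 → ℝ} {J : E4 → Fin 4 → ℝ} {x : E4}
    (hWh : DifferentiableAt ℝ Wh x) (hWR : DifferentiableAt ℝ WR x)
    (hJ : ∀ μ, DifferentiableAt ℝ (fun y ↦ J y μ) x) (hWh0 : 0 ≤ Wh x) (hWR0 : 0 ≤ WR x)
    (hB : B x ≤ ∑ μ, fderiv ℝ (fun y ↦ J y μ) x (E4.basisVector μ))
    (hℓ : ℓ x ≤ Wh x * WR x * B x)
    (hh : -eh x ≤ WR x * ∑ μ, fderiv ℝ Wh x (E4.basisVector μ) * J x μ) :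
    ℓ x - (eh x + Wh x * |∑ μ, fderiv ℝ WR x (E4.basisVector μ) * J x μ|) ≤
      ∑ μ, fderiv ℝ (fun y ↦ (Wh y * WR y) * J y μ) x (E4.basisVector μ) := by
  have hprod : ∀ μ, fderiv ℝ (fun y ↦ (Wh y * WR y) * J y μ) x (E4.basisVector μ) =
      Wh x * WR x * fderiv ℝ (fun y ↦ J y μ) x (E4.basisVector μ) +
        WR x * (fderiv ℝ Wh x (E4.basisVector μ) * J x μ) +
        Wh x * (fderiv ℝ WR x (E4.basisVector μ) * J x μ) := by
    intro μ
    rw [fderiv_fun_mul (hWh.fun_mul hWR) (hJ μ), fderiv_fun_mul hWh hWR]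
    simp only [add_apply, FunLike.coe_smul, Pi.smul_apply, smul_eq_mul]
    ring
  simp only [hprod, Finset.sum_add_distrib, ← Finset.mul_sum]
  have h1 : Wh x * WR x * B x ≤ Wh x * WR x * ∑ μ, fderiv ℝ (fun y ↦ J y μ) x (E4.basisVector μ) :=
    mul_le_mul_of_nonneg_left hB (mul_nonneg hWh0 hWR0)
  have h3 : -(Wh x * |∑ μ, fderiv ℝ WR x (E4.basisVector μ) * J x μ|) ≤
      Wh x * ∑ μ, fderiv ℝ WR x (E4.basisVector μ) * J x μ := by
    rw [← mul_neg]
    exact mul_le_mul_of_nonneg_left (neg_abs_le _) hWh0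
  linarith

/-! ### The horizon-layer error tends to zero -/

/-- **The slab integral of the horizon-layer error density tends to `0` as `ε_n = ε/(n+1) → 0`.**
The densities `e_n = W_R · K χ′(u₂/ε_n − 1)(u₂/ε_n) D/M` (`D` continuous) along the leaves
`(u + F(y), y)` are continuous, bounded by `4K|D|/M` (`0 ≤ χ′(t)(t+1) ≤ 4`), vanish for
`‖y‖ > 2R`, and at every point vanish for `n` large (`χ′(u₂/ε_n − 1) = 0` once `u₂ > 2ε_n`, or
always if `u₂ ≤ 0`): dominated convergence in `y` (bound `4K/M 𝟙_{‖y‖≤2R} |D|`) and then in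
`u ∈ (0, s]` (bound the continuous parametric integral of the latter). Also recorded: the
`u`-integrability of the leaf integrals and the continuity of `e_n`. DRSR arXiv:1402.7034, §13.2.
[folklore] -/
theorem degILED_horizonError_tendsto {M ε R Kh s : ℝ} (hM : 0 < M) (hε : 0 < ε) (hR : 0 < R)
    (hKh : 0 ≤ Kh) {F : E3 → ℝ} (hF : Continuous F) {Dm : E4 → ℝ} (hDm : Continuous Dm)
    {eh : ℕ → E4 → ℝ} (heh : eh = fun (n : ℕ) (x : E4) ↦
      Real.smoothTransition (2 - E4.spatialNorm x ^ 2 / R ^ 2) *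
        (Kh * (deriv Real.smoothTransition (Kerr.horizonFn M 0 x / (ε / (n + 1)) - 1) *
          (Kerr.horizonFn M 0 x / (ε / (n + 1)))) / M * Dm x)) :
    Tendsto (fun n ↦ ∫ u in Ioc 0 s, ∫ y : E3, eh n (E4.ofTimeSpace (u + F y) y)) atTop (𝓝 0) ∧
      (∀ n, Integrable (fun u ↦ ∫ y : E3, eh n (E4.ofTimeSpace (u + F y) y))
        (volume.restrict (Ioc 0 s))) ∧ ∀ n, Continuous (eh n) := by
  have hLc : Continuous fun z : ℝ × E3 ↦ E4.ofTimeSpace (z.1 + F z.2) z.2 :=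
    E4.continuous_ofTimeSpace' (continuous_fst.add (hF.comp continuous_snd)) continuous_snd
  have hLu : ∀ u : ℝ, Continuous fun y : E3 ↦ E4.ofTimeSpace (u + F y) y := fun u ↦
    E4.continuous_ofTimeSpace' (continuous_const.add hF) continuous_id
  have hεn : ∀ n : ℕ, 0 < ε / ((n : ℝ) + 1) := fun n ↦ by positivity
  -- continuity, uniform bound and support of the densities
  have hehc : ∀ n : ℕ, Continuous (eh n) := fun n ↦ by
    rw [heh]
    exact (Real.smoothTransition.continuous.comp
      (continuous_const.sub ((E4.continuous_spatialNorm.pow 2).div_const _))).mul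
      (((continuous_const.mul
        (((Real.smoothTransition.contDiff (n := 1)).continuous_deriv le_rfl).comp
          (((Kerr.continuous_horizonFn M 0).div_const _).sub continuous_const) |>.mul
          ((Kerr.continuous_horizonFn M 0).div_const _))).div_const M).mul hDm)
  have hb1 : ∀ (n : ℕ) (x : E4), |eh n x| ≤ 4 * Kh / M * |Dm x| := by
    intro n x
    obtain ⟨h0, h4⟩ := degILED_deriv_mul_bounds (Kerr.horizonFn M 0 x / (ε / (n + 1)) - 1)
    rw [sub_add_cancel] at h0 h4
    rw [heh]
    dsimp only
    rw [abs_mul, abs_mul, abs_div, abs_mul, abs_of_nonneg (Real.smoothTransition.nonneg _),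
      abs_of_nonneg hKh, abs_of_nonneg h0, abs_of_pos hM]
    calc _ ≤ 1 * (Kh * 4 / M * |Dm x|) := by
          gcongr
          exact Real.smoothTransition.le_one _
      _ = _ := by ring
  have hb0 : ∀ (n : ℕ) (u : ℝ) (y : E3), 2 * R < ‖y‖ → eh n (E4.ofTimeSpace (u + F y) y) = 0 := by
    intro n u y hy
    rw [heh]
    dsimp only
    rw [Real.smoothTransition.zero_of_nonpos, zero_mul]
    rw [E4.spatialNorm_ofTimeSpace, sub_nonpos, le_div_iff₀ (by positivity)]
    nlinarith [hR, norm_nonneg y]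
  -- the dominating functions
  set bd : ℝ → E3 → ℝ := fun u y ↦ 4 * Kh / M *
    (closedBall (0 : E3) (2 * R)).indicator (fun y ↦ |Dm (E4.ofTimeSpace (u + F y) y)|) y with hbd
  have hbdle : ∀ (n : ℕ) (u : ℝ) (y : E3), ‖eh n (E4.ofTimeSpace (u + F y) y)‖ ≤ bd u y := by
    intro n u y
    rw [Real.norm_eq_abs]
    by_cases hy : y ∈ closedBall (0 : E3) (2 * R)
    · simp only [hbd, indicator_of_mem hy]
      exact hb1 n _
    · have hy' : 2 * R < ‖y‖ := by rwa [mem_closedBall_zero_iff, not_le] at hy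
      simp only [hbd, indicator_of_notMem hy, mul_zero, hb0 n u y hy', abs_zero, le_refl]
  have hbdi : ∀ u, Integrable (bd u) := fun u ↦
    ((((hDm.comp (hLu u)).abs).continuousOn.integrableOn_compact
      (isCompact_closedBall _ _)).integrable_indicator measurableSet_closedBall).const_mul _
  -- the pointwise limit: eventually zero
  have hlim : ∀ (u : ℝ) (y : E3),
      Tendsto (fun n : ℕ ↦ eh n (E4.ofTimeSpace (u + F y) y)) atTop (𝓝 0) := by
    intro u y
    refine tendsto_const_nhds.congr' ?_
    rcases le_or_gt (Kerr.horizonFn M 0 (E4.ofTimeSpace (u + F y) y)) 0 with h0 | hpos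
    · refine Eventually.of_forall fun n ↦ ?_
      have h1 : Kerr.horizonFn M 0 (E4.ofTimeSpace (u + F y) y) / (ε / (n + 1)) - 1 < 0 := by
        have : Kerr.horizonFn M 0 (E4.ofTimeSpace (u + F y) y) / (ε / (n + 1)) ≤ 0 :=
          div_nonpos_iff.mpr (Or.inr ⟨h0, (hεn n).le⟩)
        linarith
      rw [heh]
      beta_reduce
      rw [Literature.Topology.FourManifolds.deriv_smoothTransition_eq_zero (Or.inl h1)]
      simp
    · obtain ⟨N, hN⟩ := exists_nat_gt (2 * ε / Kerr.horizonFn M 0 (E4.ofTimeSpace (u + F y) y))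
      refine Filter.eventually_atTop.2 ⟨N, fun n hn ↦ ?_⟩
      have h1 : 1 < Kerr.horizonFn M 0 (E4.ofTimeSpace (u + F y) y) / (ε / (n + 1)) - 1 := by
        rw [div_lt_iff₀ hpos] at hN
        have hn' : (N : ℝ) ≤ n := Nat.cast_le.mpr hn
        rw [lt_sub_iff_add_lt, lt_div_iff₀ (hεn n), mul_div_assoc', div_lt_iff₀ (by positivity)]
        nlinarith
      rw [heh]
      beta_reduce
      rw [Literature.Topology.FourManifolds.deriv_smoothTransition_eq_zero (Or.inr h1)]
      simp
  -- dominated convergence in `y`, then in `u`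
  have hinner : ∀ u : ℝ,
      Tendsto (fun n : ℕ ↦ ∫ y : E3, eh n (E4.ofTimeSpace (u + F y) y)) atTop (𝓝 0) := fun u ↦ by
    simpa using tendsto_integral_of_dominated_convergence (bd u)
      (fun n ↦ ((hehc n).comp (hLu u)).aestronglyMeasurable) (hbdi u)
      (fun n ↦ Eventually.of_forall (hbdle n u)) (Eventually.of_forall (hlim u))
  have hβc : Continuous fun u ↦ ∫ y, bd u y := by
    have heq : (fun u ↦ ∫ y, bd u y) = fun u ↦ 4 * Kh / M *
        ∫ y in closedBall (0 : E3) (2 * R), |Dm (E4.ofTimeSpace (u + F y) y)| := by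
      funext u
      simp only [hbd, integral_const_mul, integral_indicator measurableSet_closedBall]
    rw [heq]
    exact continuous_const.mul (continuous_parametric_integral_of_continuous
      (f := fun (u : ℝ) (y : E3) ↦ |Dm (E4.ofTimeSpace (u + F y) y)|) (hDm.comp hLc).abs
      (isCompact_closedBall _ _))
  have hβi : Integrable (fun u ↦ ∫ y, bd u y) (volume.restrict (Ioc 0 s)) := hβc.integrableOn_Ioc
  have hmeas : ∀ n : ℕ, AEStronglyMeasurable (fun u : ℝ ↦ ∫ y : E3, eh n (E4.ofTimeSpace (u + F y) y))
      (volume.restrict (Ioc 0 s)) := fun n ↦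
    (((hehc n).comp hLc).stronglyMeasurable.integral_prod_right' (ν := volume)).aestronglyMeasurable
  have hnb : ∀ (n : ℕ) (u : ℝ), ‖∫ y : E3, eh n (E4.ofTimeSpace (u + F y) y)‖ ≤ ∫ y, bd u y :=
    fun n u ↦ norm_integral_le_of_norm_le (hbdi u) (Eventually.of_forall (hbdle n u))
  refine ⟨?_, fun n ↦ hβi.mono' (hmeas n) (Eventually.of_forall (hnb n)), hehc⟩
  simpa using tendsto_integral_of_dominated_convergence (μ := volume.restrict (Ioc 0 s))
    (fun u ↦ ∫ y, bd u y) hmeas hβi (fun n ↦ Eventually.of_forall (hnb n))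
    (Eventually.of_forall hinner)

/-! ### Measure-theoretic bookkeeping -/

/-- **From a pointwise bound to a bound of the real integral by a Lebesgue integral**: if
`|g| ≤ c q 𝟙_S` (`c ≥ 0`, `S` measurable) and `∫⁻_S q < ∞`, then `|∫ g| ≤ c ∫⁻_S q`
(`MeasureTheory.norm_integral_le_lintegral_norm`; no integrability of `g` is needed). [folklore] -/
theorem degILED_abs_integral_le {g q : E3 → ℝ} {S : Set E3} (hS : MeasurableSet S) {c : ℝ}
    (hc : 0 ≤ c) (hg : ∀ y, |g y| ≤ S.indicator (fun y ↦ c * q y) y)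
    (hfin : ∫⁻ y in S, ENNReal.ofReal (q y) ≠ ⊤) :
    |∫ y, g y| ≤ c * (∫⁻ y in S, ENNReal.ofReal (q y)).toReal := by
  have h1 := norm_integral_le_lintegral_norm (μ := volume) g
  rw [Real.norm_eq_abs] at h1
  refine h1.trans ?_
  rw [← ENNReal.toReal_ofReal hc, ← ENNReal.toReal_mul]
  refine ENNReal.toReal_mono (ENNReal.mul_ne_top ENNReal.ofReal_ne_top hfin) ?_
  rw [← lintegral_indicator hS, ← lintegral_const_mul' _ _ ENNReal.ofReal_ne_top]
  refine lintegral_mono fun y ↦ ?_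
  rw [Real.norm_eq_abs]
  refine (ENNReal.ofReal_le_ofReal (hg y)).trans ?_
  by_cases hy : y ∈ S
  · rw [indicator_of_mem hy, indicator_of_mem hy, ENNReal.ofReal_mul hc]
  · rw [indicator_of_notMem hy, indicator_of_notMem hy, ENNReal.ofReal_zero, mul_zero]

/-- **Exhaustion of the exterior by slabs.** For `M > 0`, `F` continuous and `b` continuous at the
points with `r > 0`: if `∫_{u∈(0,n]} ∫_{2M<‖y‖≤n} b(u + F(y), y) ≤ Λ` for every `n`, then
`∫_{u∈(0,∞)} ∫_{2M<‖y‖} b(u + F(y), y) ≤ Λ` (`[0, ∞]`-valued integrals of `b⁺ = ENNReal.ofReal b`).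
The leaf integrals are space-time integrals of the measurable modification
`χ(r/M − 1) b` (continuous on `ℝ⁴`, `= b` on `{r ≥ 2M}`) over the regions
`{2M < ‖x⃗‖ ≤ n, x⁰ − F(x⃗) ∈ (0, n]}` (`Kerr.lintegral_lintegral_leafPoint_eq`), which increase to
`{2M < ‖x⃗‖, x⁰ > F(x⃗)}` (`MeasureTheory.setLIntegral_iUnion_of_directed`). [folklore] -/
theorem degILED_exhaustion : ∀ (M : ℝ) (F : E3 → ℝ) (b : E4 → ℝ) (Λ : ENNReal), 0 < M → Continuous F → (∀ x : E4, 0 < Kerr.radius 0 x → ContinuousAt b x) → (∀ n : ℕ, ∫⁻ u in Set.Ioc (0 : ℝ) n, ∫⁻ y in {y : E3 | 2 * M < ‖y‖ ∧ ‖y‖ ≤ n}, ENNReal.ofReal (b (E4.ofTimeSpace (u + F y) y)) ≤ Λ) → ∫⁻ u in Set.Ioi (0 : ℝ), ∫⁻ y in {y : E3 | 2 * M < ‖y‖}, ENNReal.ofReal (b (E4.ofTimeSpace (u + F y) y)) ≤ Λ := by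
  intro M F b Λ hM hF hb h
  -- a measurable (continuous) modification of `b⁺`
  set G : E4 → ℝ≥0∞ := fun x ↦
    ENNReal.ofReal (Real.smoothTransition (Kerr.radius 0 x / M - 1) * b x) with hG
  have hGc : Continuous fun x ↦ Real.smoothTransition (Kerr.radius 0 x / M - 1) * b x := by
    refine continuous_iff_continuousAt.2 fun x ↦ ?_
    have hrc := Kerr.continuous_radius (0 : ℝ)
    refine continuousAt_weight_mul (K := {x : E4 | M ≤ Kerr.radius 0 x})
      (U := {x : E4 | 0 < Kerr.radius 0 x}) (V := fun y ↦ Real.smoothTransition (Kerr.radius 0 y / M - 1))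
      (isClosed_le continuous_const hrc) (fun x hx ↦ hM.trans_le hx)
      (Real.smoothTransition.continuous.comp (by fun_prop))
      (fun x hx ↦ Real.smoothTransition.zero_of_nonpos ?_) hb x
    have hlt : Kerr.radius 0 x < M := not_le.mp hx
    rw [sub_nonpos, div_le_one hM]
    exact hlt.le
  have hGm : Measurable G := ENNReal.measurable_ofReal.comp hGc.measurable
  have hS : MeasurableSet {y : E3 | 2 * M < ‖y‖} :=
    (isOpen_lt continuous_const continuous_norm).measurableSet
  have hSn : ∀ n : ℕ, MeasurableSet {y : E3 | 2 * M < ‖y‖ ∧ ‖y‖ ≤ n} := fun n ↦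
    hS.inter (isClosed_le continuous_norm continuous_const).measurableSet
  -- leaf integrals over subsets of `{2M < ‖y‖}` are space-time integrals of `G`
  have key : ∀ {T : Set ℝ} {S : Set E3}, MeasurableSet T → MeasurableSet S →
      S ⊆ {y : E3 | 2 * M < ‖y‖} →
      ∫⁻ u in T, ∫⁻ y in S, ENNReal.ofReal (b (E4.ofTimeSpace (u + F y) y)) =
        ∫⁻ x in {x : E4 | E4.spatial x ∈ S ∧ x 0 - F (E4.spatial x) ∈ T}, G x := by
    intro T S hT hS' hsub
    rw [← Kerr.lintegral_lintegral_leafPoint_eq hF.measurable hGm hT hS']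
    refine lintegral_congr fun u ↦ setLIntegral_congr_fun hS' fun y hy ↦ ?_
    have hy2 : 2 * M < ‖y‖ := hsub hy
    simp only [hG, Kerr.leafPoint]
    rw [Real.smoothTransition.one_of_one_le, one_mul]
    rw [Kerr.radius_zero_left, E4.spatialNorm_ofTimeSpace, le_sub_iff_add_le, le_div_iff₀ hM]
    linarith
  rw [key measurableSet_Ioi hS subset_rfl]
  have hU : {x : E4 | E4.spatial x ∈ {y : E3 | 2 * M < ‖y‖} ∧ x 0 - F (E4.spatial x) ∈ Ioi (0 : ℝ)} =
      ⋃ n : ℕ, {x : E4 | E4.spatial x ∈ {y : E3 | 2 * M < ‖y‖ ∧ ‖y‖ ≤ n} ∧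
        x 0 - F (E4.spatial x) ∈ Ioc (0 : ℝ) n} := by
    ext x
    simp only [mem_setOf_eq, mem_iUnion, mem_Ioi, mem_Ioc]
    constructor
    · rintro ⟨h1, h2⟩
      obtain ⟨n, hn⟩ := exists_nat_ge (max ‖E4.spatial x‖ (x 0 - F (E4.spatial x)))
      exact ⟨n, ⟨h1, (le_max_left _ _).trans hn⟩, h2, (le_max_right _ _).trans hn⟩
    · rintro ⟨n, ⟨h1, -⟩, h2, -⟩
      exact ⟨h1, h2⟩
  rw [hU, setLIntegral_iUnion_of_directed]
  · refine iSup_le fun n ↦ ?_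
    rw [← key measurableSet_Ioc (hSn n) (fun y hy ↦ hy.1)]
    exact h n
  · refine Monotone.directed_le fun n m hnm x hx ↦ ?_
    have hc : (n : ℝ) ≤ m := Nat.cast_le.mpr hnm
    obtain ⟨⟨h1, h2⟩, h3, h4⟩ := hx
    exact ⟨⟨h1, h2.trans hc⟩, h3, h4.trans hc⟩

end Summit.FinalStateConjecture.FinalStateConjecture.Theorems
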